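import Mathlib
import HarnessLib
import Summits.HubbardSuperconductivity.HubbardSuperconductivity.Theorems.KLProgrammeKLRegimeEngineV8E5Share

/-!
# K3 ENGINE package, `Q`-level v8: `klEngQ8 P R := (klEngQ7 P R).withCR (max (klEngQ7 P R).CR (klE5Raise P R))`
# (token #13 `klEngQ7 ↦ klEngQ8` of the v2 re-registration of the 20437 engine-flow skeleton, plan g17 (R47a)/(R47n))

Cell `gate-hubbard-kl`, seat hubbard-kl-k3c2-p1 g5 (v2 Defs batch booked to this lineage, KL STATUS 2026-08-27 l.3158/l.3170/l.3174).

WHY ((E5-CR)/(R47)).  Stub (c) budgets the E.5 two-vertex classes of the step `n−1 → n` by `eremBar`'s `Q.CR·(P.Klam·|U|)³·2^{−n}`; their share is the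
DEFERRED constant `klE5Raise P R` of class #3 (`…EngineV8E5Share`, `E5ShareStep` quantified over the packages `(klEngQ7 P R).withCR r`, `r ≥ (klEngQ7 P R).CR`),
so the v2 package raises `CR` — and NOTHING else — to dominate both the v7 budget and that share:

* §1 generic **`EngConsts.withCR` doors** (the base module `…EngineV8WithCR` has the `rfl` field rows): the `CR`-readers `legDressBarQ2`, `eremBar`,
  `frameShiftBar`, (B1-F)'s tolerance are MONOTONE in `CR`, so along `Q ↦ Q.withCR r` with `Q.CR ≤ r` every value clause of the flow slot lifts
  CONCLUSION-SIDE (`pairLadderStepAtV17F2_withCR_of`, `pairValueIncrementAtV17F_withCR_of`, `quarticValueIncrementAtV17F_withCR_of`,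
  `quarticValueUVAtV17F_withCR_of`, `pairArrayAtV17F_withCR_of`, `betaSplitAtV17F_withCR_of`, `engineBoundsAtV17F2_withCR_of`, `histV17F2_withCR_of`);
  the `CE`/`S'`/`cE4`-readers are `Iff.rfl` (`kernelNormsV4_withCR_iff`, `kernelNormsLevels_withCR_iff`, `klWtBudget_withCR`, `engineFirstMoments_withCR_iff`,
  `twoLegReadJetsF_withCR_iff`); `IsoTupleL1AtV17F`, `RenormFlowAtV17F`, `TwoLegSlopes` do not read `Q`.
  NOT provided (false in general): a lift of `TwoLegStepV17F2 … Q …` or of `HistP klPredsV17F2 … Q …` at `n ≥ 1` — (E3f-F) `TwoLegVolumeRateF` takes the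
  comparison-volume HISTORY `histV17F2 … Q …` as a HYPOTHESIS (antitone), so the two-leg slot is neither monotone nor antitone in `CR`; this is exactly
  why (R47n) has the (C)/(M) re-closers written `CR`-generically (at `Q₀.withCR r`, all `r ≥ Q₀.CR`) rather than lifted.  At `n = 0` the history is empty
  and `twoLegVolumeRateF_zero_withCR_iff` holds;
* §2 **`klEngQ8 P R`**, `klEngQ8_eq`, `klEngQ8_wf`, `klEngQ8_CR`, `klEngQ7_CR_le_klEngQ8_CR`, `klE5Raise_le_klEngQ8_CR`, `klEngQ8_CE` (`= (klEngQ7 P R).CE`, `rfl`)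
  with the `CE`-threshold riders (`klWtCE_le_klEngQ8_CE`, `klE1CE_le_klEngQ8_CE`, `klCE6_le_klEngQ8_CE`), the untouched rows `S'`, `c0`, `cE4`, `Bf`, `SL`,
  `CL`, `L0`, `M0` (`rfl` against `klEngQ7`), `deltaUV_absorbed8`;
* §3 the instantiated doors `klEngQ7 ⟶ klEngQ8` (`…_klEngQ8_iff`, `…_klEngQ8_of_klEngQ7`, `engineBoundsAtV17F2_klEngQ8_iff_of_values`).

Registrant token #13: `klEngQ7 ↦ klEngQ8` (+ `klEngQ7_wf ↦ klEngQ8_wf`, this import).  Definitions with bodies + order lemmas only; nothing about the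
model is asserted; nothing asserts superconductivity.
-/

noncomputable section

/-! ## §1 Generic `withCR` doors -/

namespace Summit.HubbardSuperconductivity.HubbardSuperconductivity.Theorems.KLRegimeSplit

set_option linter.dupNamespace false -- summit = problem name (single-conjunct summit), D-0017

open Real Finset Literature.MathematicalPhysics.QuantumLattice Literature.Probability.LatticeModels
open Summit.HubbardSuperconductivity.HubbardSuperconductivity.Theorems.KLProgrammeLegKernels
open Summit.HubbardSuperconductivity.HubbardSuperconductivity.Theorems.EngineV8

section Bars

variable (G : GeoConsts) (P : SplitConsts) (Q : EngConsts) (r : ℝ)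

/-- `twoLegBar` reads only `S'` (untouched by `withCR`). -/
theorem twoLegBar_withCR (U : ℝ) (j n : ℕ) : twoLegBar G (Q.withCR r) U j n = twoLegBar G Q U j n := rfl

/-- The (E1-W) budget reads only `CE` (untouched by `withCR`). -/
theorem klWtBudget_withCR (U : ℝ) (j m : ℕ) : klWtBudget P (Q.withCR r) U j m = klWtBudget P Q U j m := rfl

/-- `legDressBarQ2` at `Q.withCR r` is the `CR := r` reading. -/
theorem legDressBarQ2_withCR (U : ℝ) (n c : ℕ) : legDressBarQ2 G P (Q.withCR r) U n c = r * ((P.Klam * U) ^ 2 + (P.Klam * |U|) ^ 3) * c := rfl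

/-- `frameShiftBar` at `Q.withCR r` is the `CR := r` reading. -/
theorem frameShiftBar_withCR (U : ℝ) (n : ℕ) : frameShiftBar P (Q.withCR r) U n = r * (P.Klam * U) ^ 2 * ((4 : ℝ)⁻¹) ^ n := rfl

variable {Q r}

/-- **`legDressBarQ2` is monotone along the `CR`-raise** (`Q.CR ≤ r`, `0 ≤ P.Klam`). -/
theorem legDressBarQ2_le_withCR (hr : Q.CR ≤ r) (hK : 0 ≤ P.Klam) (U : ℝ) (n c : ℕ) :
    legDressBarQ2 G P Q U n c ≤ legDressBarQ2 G P (Q.withCR r) U n c := by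
  rw [legDressBarQ2_eq, legDressBarQ2_withCR]
  have h1 : 0 ≤ ((P.Klam * U) ^ 2 + (P.Klam * |U|) ^ 3) * (c : ℝ) :=
    mul_nonneg (add_nonneg (sq_nonneg _) (pow_nonneg (mul_nonneg hK (abs_nonneg U)) 3)) (Nat.cast_nonneg c)
  calc Q.CR * ((P.Klam * U) ^ 2 + (P.Klam * |U|) ^ 3) * (c : ℝ) = Q.CR * (((P.Klam * U) ^ 2 + (P.Klam * |U|) ^ 3) * (c : ℝ)) := by ring
    _ ≤ r * (((P.Klam * U) ^ 2 + (P.Klam * |U|) ^ 3) * (c : ℝ)) := mul_le_mul_of_nonneg_right hr h1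
    _ = _ := by ring

/-- **`frameShiftBar` is monotone along the `CR`-raise** (`Q.CR ≤ r`). -/
theorem frameShiftBar_le_withCR (hr : Q.CR ≤ r) (U : ℝ) (n : ℕ) : frameShiftBar P Q U n ≤ frameShiftBar P (Q.withCR r) U n := by
  rw [frameShiftBar_withCR]
  unfold frameShiftBar
  have h1 : 0 ≤ (P.Klam * U) ^ 2 * ((4 : ℝ)⁻¹) ^ n := mul_nonneg (sq_nonneg _) (pow_nonneg (by norm_num) _)
  calc Q.CR * (P.Klam * U) ^ 2 * ((4 : ℝ)⁻¹) ^ n = Q.CR * ((P.Klam * U) ^ 2 * ((4 : ℝ)⁻¹) ^ n) := by ring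
    _ ≤ r * ((P.Klam * U) ^ 2 * ((4 : ℝ)⁻¹) ^ n) := mul_le_mul_of_nonneg_right hr h1
    _ = _ := by ring

/-- **`eremBar` is monotone along the `CR`-raise** (`Q.CR ≤ r`, `0 ≤ P.Klam`; `CL` untouched). -/
theorem eremBar_le_withCR (hr : Q.CR ≤ r) (hK : 0 ≤ P.Klam) (U β : ℝ) (L n : ℕ) :
    eremBar G P Q U β L n ≤ eremBar G P (Q.withCR r) U β L n := by
  unfold eremBar
  rw [EngConsts.withCR_CR, EngConsts.withCR_CL]
  have h1 : 0 ≤ (P.Klam * |U|) ^ 3 * ((2 : ℝ) ^ n)⁻¹ := mul_nonneg (pow_nonneg (mul_nonneg hK (abs_nonneg U)) 3) (by positivity)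
  have h2 : Q.CR * (P.Klam * |U|) ^ 3 * ((2 : ℝ) ^ n)⁻¹ ≤ r * (P.Klam * |U|) ^ 3 * ((2 : ℝ) ^ n)⁻¹ := by
    calc Q.CR * (P.Klam * |U|) ^ 3 * ((2 : ℝ) ^ n)⁻¹ = Q.CR * ((P.Klam * |U|) ^ 3 * ((2 : ℝ) ^ n)⁻¹) := by ring
      _ ≤ r * ((P.Klam * |U|) ^ 3 * ((2 : ℝ) ^ n)⁻¹) := mul_le_mul_of_nonneg_right hr h1
      _ = _ := by ring
  linarith

end Bars

section Model

variable {L M : ℕ} [NeZero L] [NeZero M] {G : GeoConsts} {P : SplitConsts} {Q : EngConsts} {R : RenConsts} {β U μ : ℝ}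
  {K : TrigPolyC4v} {n : ℕ} {r : ℝ}

omit [NeZero M] in
/-- (E1-v4) is unchanged by `withCR` (reads `CE`). -/
theorem kernelNormsV4_withCR_iff : KernelNormsV4 L M P (Q.withCR r) β U μ K n ↔ KernelNormsV4 L M P Q β U μ K n := Iff.rfl

omit [NeZero M] in
/-- The levelled norms are unchanged by `withCR` (read `CE`). -/
theorem kernelNormsLevels_withCR_iff : KernelNormsLevels L M P (Q.withCR r) β U μ K n ↔ KernelNormsLevels L M P Q β U μ K n := Iff.rfl

omit [NeZero M] in
/-- The weighted levels at the (E1-W) budget are unchanged by `withCR` (the budget reads `CE`). -/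
theorem kernelNormsWt4_klWtBudget_withCR_iff {j : ℕ} :
    KernelNormsWt4 L M (klWtBudget P (Q.withCR r) U j) β U μ K j ↔ KernelNormsWt4 L M (klWtBudget P Q U j) β U μ K j := Iff.rfl

/-- (E4) is unchanged by `withCR` (reads `Q.cE4`). -/
theorem engineFirstMoments_withCR_iff :
    EngineFirstMoments L M G P (Q.withCR r) β U μ K n ↔ EngineFirstMoments L M G P Q β U μ K n := Iff.rfl

/-- (E3a-F) is unchanged by `withCR` (reads `Q.S'`). -/
theorem twoLegReadJetsF_withCR_iff : TwoLegReadJetsF L M G (Q.withCR r) β U μ n ↔ TwoLegReadJetsF L M G Q β U μ n := Iff.rfl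

/-- (E3f-F) at `n = 0` is unchanged by `withCR` for ANY two histories (the history enters only through `∀ j < 0`, and the clause reads `Q.M0`, `Q.CL`). -/
theorem twoLegVolumeRateF_zero_withCR_iff (hist hist' : (L' M' : ℕ) → [NeZero L'] → [NeZero M'] → ℕ → Prop) :
    TwoLegVolumeRateF L M hist (Q.withCR r) β U μ 0 ↔ TwoLegVolumeRateF L M hist' Q β U μ 0 := by
  unfold TwoLegVolumeRateF
  simp only [EngConsts.withCR_M0, EngConsts.withCR_CL, Nat.not_lt_zero, IsEmpty.forall_iff, implies_true, forall_const]

/-- **(E2-F2)ₙ lifts along the `CR`-raise** (`Q.CR ≤ r`, `0 ≤ P.Klam`; every scale `n`). -/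
theorem pairLadderStepAtV17F2_withCR_of (hr : Q.CR ≤ r) (hK : 0 ≤ P.Klam) (h : PairLadderStepAtV17F2 L M G P Q β U μ n) :
    PairLadderStepAtV17F2 L M G P (Q.withCR r) β U μ n := by
  refine ⟨fun hn Qm k hk k' hk' => (h.1 hn Qm k hk k' hk').trans ?_, fun hn Qm hQm => ?_⟩
  · have := legDressBarQ2_le_withCR G P hr hK U 0 4
    linarith
  · obtain ⟨w, hw1, hw2, N, hN, hb⟩ := h.2 hn Qm hQm
    refine ⟨w, hw1, hw2, N, hN, fun k hk k' hk' => (hb k hk k' hk').trans ?_⟩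
    have h1 := eremBar_le_withCR G P hr hK U β L (n - 1)
    have h2 := legDressBarQ2_le_withCR G P hr hK U n (legSliceCountT L β μ (klFlowFrameU L M β U μ n) n ![k', Qm - k', Qm - k, k])
    have h3 := frameShiftBar_le_withCR P hr U n
    linarith

/-- **(E2″-F)ₙ lifts along the `CR`-raise** (`Q.CR ≤ r`, `0 ≤ P.Klam`). -/
theorem pairValueIncrementAtV17F_withCR_of (hr : Q.CR ≤ r) (hK : 0 ≤ P.Klam) (h : PairValueIncrementAtV17F L M G P Q β U μ n) :
    PairValueIncrementAtV17F L M G P (Q.withCR r) β U μ n := by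
  intro hn Qm k hk k' hk'
  refine (h hn Qm k hk k' hk').trans ?_
  have h1 := eremBar_le_withCR G P hr hK U β L (n - 1)
  have h2 := legDressBarQ2_le_withCR G P hr hK U n (legSliceCountT L β μ (klFlowFrameU L M β U μ n) n ![k', Qm - k', Qm - k, k])
  have h3 := frameShiftBar_le_withCR P hr U n
  linarith

/-- **(E2′-F)ₙ lifts along the `CR`-raise** (`Q.CR ≤ r`, `0 ≤ P.Klam`). -/
theorem quarticValueIncrementAtV17F_withCR_of (hr : Q.CR ≤ r) (hK : 0 ≤ P.Klam) (h : QuarticValueIncrementAtV17F L M G P Q β U μ n) :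
    QuarticValueIncrementAtV17F L M G P (Q.withCR r) β U μ n := by
  intro hn k₁ hk₁ k₂ hk₂ k₃ hk₃
  refine (h hn k₁ hk₁ k₂ hk₂ k₃ hk₃).trans ?_
  have h1 := eremBar_le_withCR G P hr hK U β L (n - 1)
  have h2 := legDressBarQ2_le_withCR G P hr hK U n (legSliceCountT L β μ (klFlowFrameU L M β U μ n) n ![k₁, k₂, k₃, k₁ - k₂ + k₃])
  have h3 := frameShiftBar_le_withCR P hr U n
  linarith

/-- **(E2′-F UV) lifts along the `CR`-raise** (`Q.CR ≤ r`, `0 ≤ P.Klam`). -/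
theorem quarticValueUVAtV17F_withCR_of (hr : Q.CR ≤ r) (hK : 0 ≤ P.Klam) (h : QuarticValueUVAtV17F L M G P Q β U μ n) :
    QuarticValueUVAtV17F L M G P (Q.withCR r) β U μ n := by
  intro hn k₁ hk₁ k₂ hk₂ k₃ hk₃
  refine (h hn k₁ hk₁ k₂ hk₂ k₃ hk₃).trans ?_
  have := legDressBarQ2_le_withCR G P hr hK U 0 4
  linarith

/-- **(B1-F) lifts along the `CR`-raise** (`Q.CR ≤ r`, `0 ≤ P.Klam`; `klLegKappa = 4000 ≥ 0`). -/
theorem pairArrayAtV17F_withCR_of (hr : Q.CR ≤ r) (hK : 0 ≤ P.Klam) (h : PairArrayAtV17F L M P Q β U μ n) :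
    PairArrayAtV17F L M P (Q.withCR r) β U μ n := by
  intro Qm
  obtain ⟨u, hu0, hu, hb⟩ := h Qm
  refine ⟨u, hu0, hu, fun k hk k' hk' => (hb k hk k' hk').trans ?_⟩
  rw [EngConsts.withCR_CR]
  have hκ : (0 : ℝ) ≤ klLegKappa := by norm_num [klLegKappa]
  have h1 : klLegKappa * Q.CR * P.Klam ^ 3 ≤ klLegKappa * r * P.Klam ^ 3 :=
    mul_le_mul_of_nonneg_right (mul_le_mul_of_nonneg_left hr hκ) (pow_nonneg hK 3)
  exact mul_le_mul_of_nonneg_right (by linarith) (sq_nonneg U)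

/-- **The split slot lifts along the `CR`-raise** (`Q.CR ≤ r`, `0 ≤ P.Klam`; only (B1-F) reads `Q`). -/
theorem betaSplitAtV17F_withCR_of (hr : Q.CR ≤ r) (hK : 0 ≤ P.Klam) (h : BetaSplitAtV17F L M G P Q β U μ n) :
    BetaSplitAtV17F L M G P (Q.withCR r) β U μ n :=
  ⟨pairArrayAtV17F_withCR_of hr hK h.1, h.2⟩

/-- **The cured engine slot lifts along the `CR`-raise** (`Q.CR ≤ r`, `0 ≤ P.Klam`; every scale `n`): (E1-v4), (E4), (E5-F) verbatim, the four value
clauses monotonically. -/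
theorem engineBoundsAtV17F2_withCR_of (hr : Q.CR ≤ r) (hK : 0 ≤ P.Klam) (h : EngineBoundsAtV17F2 L M G P Q β U μ n) :
    EngineBoundsAtV17F2 L M G P (Q.withCR r) β U μ n := by
  obtain ⟨h0, h1, h2, h3, h4, h5, h6, h7⟩ := h
  exact ⟨h0, h1, pairLadderStepAtV17F2_withCR_of hr hK h2, pairValueIncrementAtV17F_withCR_of hr hK h3,
    quarticValueIncrementAtV17F_withCR_of hr hK h4, quarticValueUVAtV17F_withCR_of hr hK h5, h6, h7⟩

/-- **At the raised package the engine slot is the unraised one with the four value clauses re-read at the larger `CR`.** -/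
theorem engineBoundsAtV17F2_withCR_iff_of_values :
    EngineBoundsAtV17F2 L M G P (Q.withCR r) β U μ n ↔
      (SelfEnergySymmetric L M β U μ (klFlowFrameU L M β U μ n) n ∧ KernelNormsV4 L M P Q β U μ (klFlowFrameU L M β U μ n) n ∧
        PairLadderStepAtV17F2 L M G P (Q.withCR r) β U μ n ∧ PairValueIncrementAtV17F L M G P (Q.withCR r) β U μ n ∧
          QuarticValueIncrementAtV17F L M G P (Q.withCR r) β U μ n ∧ QuarticValueUVAtV17F L M G P (Q.withCR r) β U μ n ∧
            EngineFirstMoments L M G P Q β U μ (klFlowFrameU L M β U μ n) n ∧ IsoTupleL1AtV17F L M G P β U μ n) :=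
  Iff.rfl

/-- **The comparison-volume history conjunct `histV17F2` lifts along the `CR`-raise** (`Q.CR ≤ r`, `0 ≤ P.Klam`): split, engine monotone; renorm,
reading jets untouched.  (The two-leg SLOT does not lift: it consumes this history as a hypothesis.) -/
theorem histV17F2_withCR_of (hr : Q.CR ≤ r) (hK : 0 ≤ P.Klam) {j : ℕ} (h : histV17F2 L M G P Q R β U μ j) :
    histV17F2 L M G P (Q.withCR r) R β U μ j :=
  ⟨betaSplitAtV17F_withCR_of hr hK h.1, h.2.1, engineBoundsAtV17F2_withCR_of hr hK h.2.2.1, h.2.2.2⟩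

end Model

end Summit.HubbardSuperconductivity.HubbardSuperconductivity.Theorems.KLRegimeSplit

namespace Summit.HubbardSuperconductivity.HubbardSuperconductivity.Theorems.EngineV8

set_option linter.dupNamespace false -- summit = problem name (single-conjunct summit), D-0017

open Real Finset Literature.MathematicalPhysics.QuantumLattice Literature.Probability.LatticeModels
open Summit.HubbardSuperconductivity.HubbardSuperconductivity.Theorems.KLRegimeSplit
open Summit.HubbardSuperconductivity.HubbardSuperconductivity.Theorems.KLProgrammeLegKernels

/-! ## §2 The package `klEngQ8` -/

/-- **`klEngQ8 P R` — the engine-flow package's `Q`, v8 (token #13)**: `klEngQ7 P R` with `CR := max (klEngQ7 P R).CR (klE5Raise P R)`, NOTHING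
else moved (`EngConsts.withCR`, p5's base module; `klE5Raise P R` = the deferred E.5 share of class #3). -/
def klEngQ8 (P : SplitConsts) (R : RenConsts) : EngConsts := (klEngQ7 P R).withCR (max (klEngQ7 P R).CR (klE5Raise P R))

/-- `klEngQ8 P R = (klEngQ7 P R).withCR (max (klEngQ7 P R).CR (klE5Raise P R))` (`rfl`). -/
theorem klEngQ8_eq (P : SplitConsts) (R : RenConsts) : klEngQ8 P R = (klEngQ7 P R).withCR (max (klEngQ7 P R).CR (klE5Raise P R)) := rfl

/-- `(klEngQ8 P R).CR = max (klEngQ7 P R).CR (klE5Raise P R)`. -/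
theorem klEngQ8_CR (P : SplitConsts) (R : RenConsts) : (klEngQ8 P R).CR = max (klEngQ7 P R).CR (klE5Raise P R) := rfl

/-- **`(klEngQ7 P R).CR ≤ (klEngQ8 P R).CR`** — the lift input of every conclusion-side `CR`-reader (token #13's monotone line). -/
theorem klEngQ7_CR_le_klEngQ8_CR (P : SplitConsts) (R : RenConsts) : (klEngQ7 P R).CR ≤ (klEngQ8 P R).CR := le_max_left _ _

/-- **`klE5Raise P R ≤ (klEngQ8 P R).CR`** — the E.5 share sits inside the v8 cubic budget. -/
theorem klE5Raise_le_klEngQ8_CR (P : SplitConsts) (R : RenConsts) : klE5Raise P R ≤ (klEngQ8 P R).CR := le_max_right _ _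

/-- **`klEngQ8 P R` is well formed.** -/
theorem klEngQ8_wf (P : SplitConsts) (R : RenConsts) : (klEngQ8 P R).WF := EngConsts.withCR_max_wf (klEngQ7_wf P R) _

/-- `(klEngQ8 P R).CE = (klEngQ7 P R).CE` (`rfl`: token #13 does not touch the tree-expansion constant). -/
theorem klEngQ8_CE (P : SplitConsts) (R : RenConsts) : (klEngQ8 P R).CE = (klEngQ7 P R).CE := rfl

/-- `klWtCE R ≤ (klEngQ8 P R).CE` (the scale-`0` weighted-level threshold rides). -/
theorem klWtCE_le_klEngQ8_CE (P : SplitConsts) (R : RenConsts) : klWtCE R ≤ (klEngQ8 P R).CE := klWtCE_le_klEngQ7_CE P R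

/-- `klE1CE P ≤ (klEngQ8 P R).CE` (the (E1-v4)₀ threshold rides). -/
theorem klE1CE_le_klEngQ8_CE (P : SplitConsts) (R : RenConsts) : klE1CE P ≤ (klEngQ8 P R).CE := klE1CE_le_klEngQ7_CE P R

/-- `klCE6 P R ≤ (klEngQ8 P R).CE` (the v6 table rides). -/
theorem klCE6_le_klEngQ8_CE (P : SplitConsts) (R : RenConsts) : klCE6 P R ≤ (klEngQ8 P R).CE := klCE6_le_klEngQ7_CE P R

/-- `(klEngQ6 P R).CE ≤ (klEngQ8 P R).CE`. -/
theorem klEngQ6_CE_le_klEngQ8_CE (P : SplitConsts) (R : RenConsts) : (klEngQ6 P R).CE ≤ (klEngQ8 P R).CE := klEngQ6_CE_le_klEngQ7_CE P R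

/-- untouched field `S'` (`rfl`). -/
theorem klEngQ8_S' (P : SplitConsts) (R : RenConsts) : (klEngQ8 P R).S' = (klEngQ7 P R).S' := rfl
/-- untouched field `c0`. -/
theorem klEngQ8_c0 (P : SplitConsts) (R : RenConsts) : (klEngQ8 P R).c0 = (klEngQ7 P R).c0 := rfl
/-- untouched field `cE4`. -/
theorem klEngQ8_cE4 (P : SplitConsts) (R : RenConsts) : (klEngQ8 P R).cE4 = (klEngQ7 P R).cE4 := rfl
/-- untouched field `Bf`. -/
theorem klEngQ8_Bf (P : SplitConsts) (R : RenConsts) : (klEngQ8 P R).Bf = (klEngQ7 P R).Bf := rfl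
/-- untouched field `SL`. -/
theorem klEngQ8_SL (P : SplitConsts) (R : RenConsts) : (klEngQ8 P R).SL = (klEngQ7 P R).SL := rfl
/-- untouched field `CL`. -/
theorem klEngQ8_CL (P : SplitConsts) (R : RenConsts) : (klEngQ8 P R).CL = (klEngQ7 P R).CL := rfl
/-- untouched field `L0`. -/
theorem klEngQ8_L0 (P : SplitConsts) (R : RenConsts) : (klEngQ8 P R).L0 = (klEngQ7 P R).L0 := rfl
/-- untouched field `M0`. -/
theorem klEngQ8_M0 (P : SplitConsts) (R : RenConsts) : (klEngQ8 P R).M0 = (klEngQ7 P R).M0 := rfl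

/-- The v8 package as a `CR`-raise of the v7 one at `r := (klEngQ8 P R).CR` — the instantiation line of every `CR`-generic v2 closer
(`Q₀ := klEngQ7 P R`, `r := (klEngQ8 P R).CR`, `hr := klEngQ7_CR_le_klEngQ8_CR P R`). -/
theorem klEngQ8_eq_withCR (P : SplitConsts) (R : RenConsts) : klEngQ8 P R = (klEngQ7 P R).withCR (klEngQ8 P R).CR := rfl

/-- `deltaUV` absorption rides to v8 (`CR` only grows). -/
theorem deltaUV_absorbed8 (P : SplitConsts) (R : RenConsts) : 32 * R.Gfr 0 + 4 * R.cr ≤ (klEngQ8 P R).CR :=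
  (deltaUV_absorbed7 P R).trans (klEngQ7_CR_le_klEngQ8_CR P R)

/-! ## §3 The instantiated doors `klEngQ7 ⟶ klEngQ8` -/

section Model

variable {L M : ℕ} [NeZero L] [NeZero M] {G : GeoConsts} {P : SplitConsts} {R : RenConsts} {β U μ : ℝ} {K : TrigPolyC4v} {n : ℕ}

omit [NeZero M] in
/-- (E1-v4) at `klEngQ8` IS (E1-v4) at `klEngQ7`. -/
theorem kernelNormsV4_klEngQ8_iff : KernelNormsV4 L M P (klEngQ8 P R) β U μ K n ↔ KernelNormsV4 L M P (klEngQ7 P R) β U μ K n := Iff.rfl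

omit [NeZero M] in
/-- The levelled norms at `klEngQ8` ARE those at `klEngQ7`. -/
theorem kernelNormsLevels_klEngQ8_iff : KernelNormsLevels L M P (klEngQ8 P R) β U μ K n ↔ KernelNormsLevels L M P (klEngQ7 P R) β U μ K n :=
  Iff.rfl

omit [NeZero L] [NeZero M] in
/-- The (E1-W) budget at `klEngQ8` IS the one at `klEngQ7`. -/
theorem klWtBudget_klEngQ8 (U : ℝ) (j m : ℕ) : klWtBudget P (klEngQ8 P R) U j m = klWtBudget P (klEngQ7 P R) U j m := rfl

omit [NeZero M] in
/-- The weighted levels at the budget: `klEngQ8` IS `klEngQ7`. -/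
theorem kernelNormsWt4_klWtBudget_klEngQ8_iff {j : ℕ} :
    KernelNormsWt4 L M (klWtBudget P (klEngQ8 P R) U j) β U μ K j ↔ KernelNormsWt4 L M (klWtBudget P (klEngQ7 P R) U j) β U μ K j := Iff.rfl

/-- (E4) at `klEngQ8` IS (E4) at `klEngQ7`. -/
theorem engineFirstMoments_klEngQ8_iff :
    EngineFirstMoments L M G P (klEngQ8 P R) β U μ K n ↔ EngineFirstMoments L M G P (klEngQ7 P R) β U μ K n := Iff.rfl

/-- (E3a-F) at `klEngQ8` IS (E3a-F) at `klEngQ7` (`S'` untouched). -/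
theorem twoLegReadJetsF_klEngQ8_iff : TwoLegReadJetsF L M G (klEngQ8 P R) β U μ n ↔ TwoLegReadJetsF L M G (klEngQ7 P R) β U μ n := Iff.rfl

/-- **(E2-F2)ₙ lifts `klEngQ7 → klEngQ8`** (`P.WF`). -/
theorem pairLadderStepAtV17F2_klEngQ8_of_klEngQ7 (hP : P.WF) (h : PairLadderStepAtV17F2 L M G P (klEngQ7 P R) β U μ n) :
    PairLadderStepAtV17F2 L M G P (klEngQ8 P R) β U μ n :=
  pairLadderStepAtV17F2_withCR_of (klEngQ7_CR_le_klEngQ8_CR P R) (zero_le_one.trans hP.1) h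

/-- **(E2″-F)ₙ lifts `klEngQ7 → klEngQ8`** (`P.WF`). -/
theorem pairValueIncrementAtV17F_klEngQ8_of_klEngQ7 (hP : P.WF) (h : PairValueIncrementAtV17F L M G P (klEngQ7 P R) β U μ n) :
    PairValueIncrementAtV17F L M G P (klEngQ8 P R) β U μ n :=
  pairValueIncrementAtV17F_withCR_of (klEngQ7_CR_le_klEngQ8_CR P R) (zero_le_one.trans hP.1) h

/-- **(E2′-F)ₙ lifts `klEngQ7 → klEngQ8`** (`P.WF`). -/
theorem quarticValueIncrementAtV17F_klEngQ8_of_klEngQ7 (hP : P.WF) (h : QuarticValueIncrementAtV17F L M G P (klEngQ7 P R) β U μ n) :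
    QuarticValueIncrementAtV17F L M G P (klEngQ8 P R) β U μ n :=
  quarticValueIncrementAtV17F_withCR_of (klEngQ7_CR_le_klEngQ8_CR P R) (zero_le_one.trans hP.1) h

/-- **(E2′-F UV) lifts `klEngQ7 → klEngQ8`** (`P.WF`). -/
theorem quarticValueUVAtV17F_klEngQ8_of_klEngQ7 (hP : P.WF) (h : QuarticValueUVAtV17F L M G P (klEngQ7 P R) β U μ n) :
    QuarticValueUVAtV17F L M G P (klEngQ8 P R) β U μ n :=
  quarticValueUVAtV17F_withCR_of (klEngQ7_CR_le_klEngQ8_CR P R) (zero_le_one.trans hP.1) h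

/-- **The split slot lifts `klEngQ7 → klEngQ8`** (`P.WF`). -/
theorem betaSplitAtV17F_klEngQ8_of_klEngQ7 (hP : P.WF) (h : BetaSplitAtV17F L M G P (klEngQ7 P R) β U μ n) :
    BetaSplitAtV17F L M G P (klEngQ8 P R) β U μ n :=
  betaSplitAtV17F_withCR_of (klEngQ7_CR_le_klEngQ8_CR P R) (zero_le_one.trans hP.1) h

/-- **The cured engine slot lifts `klEngQ7 → klEngQ8`** (`P.WF`; every scale `n`). -/
theorem engineBoundsAtV17F2_klEngQ8_of_klEngQ7 (hP : P.WF) (h : EngineBoundsAtV17F2 L M G P (klEngQ7 P R) β U μ n) :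
    EngineBoundsAtV17F2 L M G P (klEngQ8 P R) β U μ n :=
  engineBoundsAtV17F2_withCR_of (klEngQ7_CR_le_klEngQ8_CR P R) (zero_le_one.trans hP.1) h

/-- **The comparison-volume history conjunct lifts `klEngQ7 → klEngQ8`** (`P.WF`). -/
theorem histV17F2_klEngQ8_of_klEngQ7 (hP : P.WF) {j : ℕ} (h : histV17F2 L M G P (klEngQ7 P R) R β U μ j) :
    histV17F2 L M G P (klEngQ8 P R) R β U μ j :=
  histV17F2_withCR_of (klEngQ7_CR_le_klEngQ8_CR P R) (zero_le_one.trans hP.1) h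

/-- **What a `klEngQ8` engine slot gives a `klEngQ7`-keyed consumer**: (E1-v4), (E4), (E5-F) verbatim at `klEngQ7`, the four value clauses at `klEngQ8`. -/
theorem engineBoundsAtV17F2_klEngQ8_iff_of_values :
    EngineBoundsAtV17F2 L M G P (klEngQ8 P R) β U μ n ↔
      (SelfEnergySymmetric L M β U μ (klFlowFrameU L M β U μ n) n ∧ KernelNormsV4 L M P (klEngQ7 P R) β U μ (klFlowFrameU L M β U μ n) n ∧
        PairLadderStepAtV17F2 L M G P (klEngQ8 P R) β U μ n ∧ PairValueIncrementAtV17F L M G P (klEngQ8 P R) β U μ n ∧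
          QuarticValueIncrementAtV17F L M G P (klEngQ8 P R) β U μ n ∧ QuarticValueUVAtV17F L M G P (klEngQ8 P R) β U μ n ∧
            EngineFirstMoments L M G P (klEngQ7 P R) β U μ (klFlowFrameU L M β U μ n) n ∧ IsoTupleL1AtV17F L M G P β U μ n) :=
  Iff.rfl

/-- (E3f-F) at `n = 0`: `klEngQ8` IS `klEngQ7`, for any two histories. -/
theorem twoLegVolumeRateF_zero_klEngQ8_iff (hist hist' : (L' M' : ℕ) → [NeZero L'] → [NeZero M'] → ℕ → Prop) :
    TwoLegVolumeRateF L M hist (klEngQ8 P R) β U μ 0 ↔ TwoLegVolumeRateF L M hist' (klEngQ7 P R) β U μ 0 :=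
  twoLegVolumeRateF_zero_withCR_iff hist hist'

/-- **The scale-`0` weighted level at the v8 package, from any witness `WtScaleZeroAt6 T`** (the DefsQ7 consumer re-read through `klWtBudget_klEngQ8`):
stub (b)'s `j = 0` line survives token #13 verbatim. -/
theorem kernelNormsWt4_zero_klWtBudget_klEngQ8_of {T : ℝ} (hT0 : 0 ≤ T) (hT : WtScaleZeroAt6 T) (P : SplitConsts) (R : RenConsts)
    (c : ℝ) (hP : P.WF) (hR : R.WF2) (hc : 0 < c) (hc₆ : c ≤ klEngC₃6 P R) (μ : ℝ) (hμ : μ ∈ klWindowC) (U : ℝ) (hU : 0 < U)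
    (hU₀ : U ≤ klEngU₀6 P R c) (β : ℝ) (hβ : klBetaMin ≤ β) (hβc : β ≤ Real.exp (c / U ^ 2)) (K : TrigPolyC4v)
    (hK : FrameOK R U (nScales β) μ K) (L M : ℕ) [NeZero L] [NeZero M] (hL : klEngL₃ β U ≤ L) (hM : klEngM₃ β U L ≤ M) :
    KernelNormsWt4 L M (klWtBudget P (klEngQ8 P R) U 0) β U μ K 0 :=
  kernelNormsWt4_zero_klWtBudget_klEngQ7_of hT0 hT P R c hP hR hc hc₆ μ hμ U hU hU₀ β hβ hβc K hK L M hL hM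

end Model

end Summit.HubbardSuperconductivity.HubbardSuperconductivity.Theorems.EngineV8

end
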